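import Literature.AnabelianGeometry.AbsoluteAnabelian.AbsTopIII.CuspidalCyclotome
import HarnessLib

/-!
# [AbsTopIII] Prop. 1.4 (ii): the maximal cuspidally central quotient `Δ^{c-cn}_{U_x} ↠ Δ_X` as a central extension

Mochizuki, *Topics in Absolute Anabelian Geometry III*, §1, Prop. 1.4 (ii), manuscript p. 31 (lit
key `paper:url-5493eb38cbb7`), verbatim: "Then we have a natural exact sequence of profinite groups
`1 → I_x → Δ^{c-cn}_{U_x} → Δ_X → 1` — where we write `Δ_{U_x} ↠ Δ^{c-cn}_{U_x}` for the maximal cuspidally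
central quotient of `Δ_{U_x}` [i.e., the maximal intermediate quotient `Δ_{U_x} ↠ Q ↠ Δ_X` such that
`Ker(Q ↠ Δ_X)` lies in the center of `Q` — cf. [Mzk19], Definition 1.1, (i)]."  (So — our reading —
`Δ^{c-cn}_{U_x} ↠ Δ_X` is a central extension of `Δ_X` whose kernel is identified with `I_x`.)

`CurveModel.lean` / `CuspidalCyclotome.lean` provide, for a homomorphism of extensions `q : E → F`
("`Π_{U_x} ↠ Π_X`"), the cuspidal kernel `N = Ker(q) ∩ Δ_E`, the modulus `[N, Δ_E]⁻`, the quotient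
`Π_{U_x}/[N, Δ_E]⁻` (`CuspidallyCentralQuotient q`) and `M_X :=` the image of `N` (`geomCyclotome q`).
This file assembles the CENTRAL EXTENSION of the display (all PROVED, no facts):

* `ccnProj q : Π_{U_x}/[N, Δ]⁻ →* Π_X` induced by `q` (`[N, Δ]⁻ ≤ Ker q`), continuous;
* `DeltaCcn q` — `Δ^{c-cn}_{U_x}`, the image of `Δ_{U_x}`; `geomCyclotome q ≤ DeltaCcn q`;
* `geomCyclotome_mul_comm` — `M_X` is CENTRAL in `Δ^{c-cn}_{U_x}`;
* `deltaCcnProj q : Δ^{c-cn}_{U_x} →* Δ_X` and `ker_deltaCcnProj` — its kernel is exactly `M_X`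
  (so `1 → M_X → Δ^{c-cn}_{U_x} → Δ_X` is exact; surjectivity on the right holds when `q` maps `Δ_{U_x}`
  onto `Δ_X`, `deltaCcnProj_surjective`).

This is the input a transgression map `Hom(M_X, Λ) → H²(Δ_X, Λ)` (Prop. 1.4 (ii), "the differential
of the `E₂`-term of the Leray spectral sequence") consumes; the identification `I_x ⥲ M_X` is the
property `IsCuspidallyCentralExtension q I_x` (`CurveModel.lean`, fact `CurveModel.Prop_1_4_ii`).
-/

noncomputable section

open scoped Pointwise

universe u

namespace Literature.AnabelianGeometry.AbsoluteAnabelian.AbsTopIII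

variable {E F : FundamentalExtension.{u}} (q : E ⟶ F)

/-- `N = Ker(q) ∩ Δ ≤ Ker(q)`. [cite: MochizukiAbsTopIII2015, Prop 1.4 (ii) p.31] -/
theorem cuspidalKernel_le_ker : cuspidalKernel q ≤ q.arith.toMonoidHom.ker :=
  inf_le_left

/-- `N ≤ Δ_{U_x}`. [cite: MochizukiAbsTopIII2015, Prop 1.4 (ii) p.31] -/
theorem cuspidalKernel_le_geom : cuspidalKernel q ≤ E.geom :=
  inf_le_right

/-- `[N, Δ]⁻ ≤ Ker(q)` (`[N, Δ] ≤ N ≤ Ker q`, and `Ker q` is closed).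
[cite: MochizukiAbsTopIII2015, Prop 1.4 (ii) p.31] -/
theorem cuspidallyCentralModulus_le_ker : cuspidallyCentralModulus q ≤ q.arith.toMonoidHom.ker := by
  unfold cuspidallyCentralModulus
  have hle : ⁅cuspidalKernel q, E.geom⁆ ≤ q.arith.toMonoidHom.ker :=
    (Subgroup.commutator_le_left _ _).trans (cuspidalKernel_le_ker q)
  have hclosed : IsClosed (q.arith.toMonoidHom.ker : Set E.arith) :=
    isClosed_singleton.preimage q.arith.continuous
  exact (Subgroup.topologicalClosure_minimal _ hle hclosed)

/-- **`Π_{U_x}/[N, Δ]⁻ →* Π_X`** induced by `q`. [cite: MochizukiAbsTopIII2015, Prop 1.4 (ii) p.31] -/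
def ccnProj : CuspidallyCentralQuotient q →* F.arith :=
  QuotientGroup.lift (cuspidallyCentralModulus q) q.arith.toMonoidHom
    (cuspidallyCentralModulus_le_ker q)

/-- `ccnProj` on classes. [cite: MochizukiAbsTopIII2015, Prop 1.4 (ii) p.31] -/
@[simp] theorem ccnProj_mk (g : E.arith) :
    ccnProj q (QuotientGroup.mk g : CuspidallyCentralQuotient q) = q.arith g :=
  QuotientGroup.lift_mk _ _ g

/-- `ccnProj` is continuous. [cite: MochizukiAbsTopIII2015, Prop 1.4 (ii) p.31] -/
theorem continuous_ccnProj : Continuous (ccnProj q) := by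
  rw [← QuotientGroup.isOpenQuotientMap_mk.continuous_comp_iff]
  have : (ccnProj q) ∘ (QuotientGroup.mk : E.arith → CuspidallyCentralQuotient q) = q.arith := by
    funext g
    exact ccnProj_mk q g
  rw [this]
  exact q.arith.continuous

/-- **`Δ^{c-cn}_{U_x}`** — the image of `Δ_{U_x}` in `Π_{U_x}/[N, Δ]⁻` ("the maximal cuspidally central
quotient `Δ_{U_x} ↠ Δ^{c-cn}_{U_x}`"). [cite: MochizukiAbsTopIII2015, Prop 1.4 (ii) p.31] -/
def DeltaCcn : Subgroup (CuspidallyCentralQuotient q) :=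
  E.geom.map (QuotientGroup.mk' (cuspidallyCentralModulus q))

/-- Membership in `Δ^{c-cn}`. [cite: MochizukiAbsTopIII2015, Prop 1.4 (ii) p.31] -/
theorem mem_DeltaCcn_iff (y : CuspidallyCentralQuotient q) :
    y ∈ DeltaCcn q ↔ ∃ g ∈ E.geom, (QuotientGroup.mk g : CuspidallyCentralQuotient q) = y :=
  Subgroup.mem_map

/-- `M_X ≤ Δ^{c-cn}_{U_x}` (`N ≤ Δ`). [cite: MochizukiAbsTopIII2015, Prop 1.4 (ii) p.31] -/
theorem geomCyclotome_le_DeltaCcn : geomCyclotome q ≤ DeltaCcn q :=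
  Subgroup.map_mono (cuspidalKernel_le_geom q)

/-- **`M_X` is central in `Δ^{c-cn}_{U_x}`** ("`Ker(Q ↠ Δ_X)` lies in the center of `Q`"): for `n ∈ N`
and `δ ∈ Δ`, `[n, δ] ∈ [N, Δ] ≤ [N, Δ]⁻`. [cite: MochizukiAbsTopIII2015, Prop 1.4 (ii) p.31] -/
theorem geomCyclotome_mul_comm {a d : CuspidallyCentralQuotient q} (ha : a ∈ geomCyclotome q)
    (hd : d ∈ DeltaCcn q) : a * d = d * a := by
  obtain ⟨n, hn, rfl⟩ := Subgroup.mem_map.mp ha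
  obtain ⟨δ, hδ, rfl⟩ := Subgroup.mem_map.mp hd
  rw [QuotientGroup.mk'_apply, QuotientGroup.mk'_apply, ← QuotientGroup.mk_mul,
    ← QuotientGroup.mk_mul, QuotientGroup.eq]
  -- `(n δ)⁻¹ (δ n) = δ⁻¹ n⁻¹ δ n = [δ⁻¹, n⁻¹] ∈ [Δ, N] = [N, Δ] ≤ [N, Δ]⁻`
  have hmem := Subgroup.commutator_mem_commutator (inv_mem hδ) (inv_mem hn)
  rw [commutatorElement_def, inv_inv, inv_inv, Subgroup.commutator_comm] at hmem
  have h : (n * δ)⁻¹ * (δ * n) = δ⁻¹ * n⁻¹ * δ * n := by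
    simp only [mul_inv_rev, mul_assoc]
  rw [h]
  exact Subgroup.le_topologicalClosure _ hmem

/-- `ccnProj` maps `Δ^{c-cn}_{U_x}` into `Δ_X`. [cite: MochizukiAbsTopIII2015, Prop 1.4 (ii) p.31] -/
theorem ccnProj_mem_geom {y : CuspidallyCentralQuotient q} (hy : y ∈ DeltaCcn q) :
    ccnProj q y ∈ F.geom := by
  obtain ⟨g, hg, rfl⟩ := Subgroup.mem_map.mp hy
  rw [QuotientGroup.mk'_apply, ccnProj_mk]
  exact q.mapsTo_geom hg

/-- **`Δ^{c-cn}_{U_x} →* Δ_X`.** [cite: MochizukiAbsTopIII2015, Prop 1.4 (ii) p.31] -/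
def deltaCcnProj : DeltaCcn q →* F.geom where
  toFun y := ⟨ccnProj q y, ccnProj_mem_geom q y.2⟩
  map_one' := Subtype.ext (by simp)
  map_mul' y z := Subtype.ext (by simp)

/-- Value of `deltaCcnProj`. [cite: MochizukiAbsTopIII2015, Prop 1.4 (ii) p.31] -/
@[simp] theorem coe_deltaCcnProj (y : DeltaCcn q) :
    ((deltaCcnProj q y : F.geom) : F.arith) = ccnProj q y :=
  rfl

/-- `deltaCcnProj` is continuous. [cite: MochizukiAbsTopIII2015, Prop 1.4 (ii) p.31] -/
theorem continuous_deltaCcnProj : Continuous (deltaCcnProj q) :=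
  Continuous.subtype_mk ((continuous_ccnProj q).comp continuous_subtype_val) _

/-- **`Ker(Δ^{c-cn}_{U_x} ↠ Δ_X) = M_X`** (the image of `N = Ker(q) ∩ Δ`): exactness of
`1 → M_X → Δ^{c-cn}_{U_x} → Δ_X` at the middle term. [cite: MochizukiAbsTopIII2015, Prop 1.4 (ii) p.31] -/
theorem ker_deltaCcnProj : (deltaCcnProj q).ker = (geomCyclotome q).subgroupOf (DeltaCcn q) := by
  ext y
  rw [MonoidHom.mem_ker, Subgroup.mem_subgroupOf]
  obtain ⟨y, hy⟩ := y
  obtain ⟨g, hg, rfl⟩ := Subgroup.mem_map.mp hy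
  constructor
  · intro h
    have h' : q.arith g = 1 := by
      have := congrArg (fun z : F.geom => (z : F.arith)) h
      simpa using this
    exact Subgroup.mem_map.mpr ⟨g, ⟨h', hg⟩, rfl⟩
  · intro h
    obtain ⟨n, hn, hng⟩ := Subgroup.mem_map.mp h
    apply Subtype.ext
    change ccnProj q (QuotientGroup.mk' _ g) = 1
    have hng' : QuotientGroup.mk' (cuspidallyCentralModulus q) n =
        QuotientGroup.mk' (cuspidallyCentralModulus q) g := hng
    rw [← hng', QuotientGroup.mk'_apply, ccnProj_mk]
    exact hn.1

/-- If `q` maps `Δ_{U_x}` ONTO `Δ_X` (a cuspidal quotient), `Δ^{c-cn}_{U_x} → Δ_X` is surjective: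
exactness on the right. [cite: MochizukiAbsTopIII2015, Prop 1.4 (ii) p.31] -/
theorem deltaCcnProj_surjective (hq : Set.SurjOn q.arith E.geom F.geom) :
    Function.Surjective (deltaCcnProj q) := by
  rintro ⟨d, hd⟩
  obtain ⟨g, hg, hgd⟩ := hq hd
  refine ⟨⟨QuotientGroup.mk g, Subgroup.mem_map.mpr ⟨g, hg, rfl⟩⟩, Subtype.ext ?_⟩
  simpa using hgd

/-- `M_X` as a subgroup of `Δ^{c-cn}_{U_x}` is commutative with every element: restatement of
centrality inside the subtype. [cite: MochizukiAbsTopIII2015, Prop 1.4 (ii) p.31] -/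
theorem subgroupOf_geomCyclotome_le_center :
    (geomCyclotome q).subgroupOf (DeltaCcn q) ≤ Subgroup.center (DeltaCcn q) := by
  intro a ha
  rw [Subgroup.mem_center_iff]
  intro d
  apply Subtype.ext
  exact (geomCyclotome_mul_comm q (Subgroup.mem_subgroupOf.mp ha) d.2).symm

/-! ### `I_x ⥲ Ker(Δ^{c-cn}_{U_x} ↠ Δ_X)` from the cuspidally-central-extension property -/

section InertiaIso

variable {q} {I : Subgroup E.arith}

/-- The map `I_x → Π_{U_x}/[N, Δ]⁻` lands in `M_X` when `I_x ≤ N` (e.g. under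
`IsCuspidallyCentralExtension q I_x`, whose `sup_eq` gives `I_x ≤ N`).
[cite: MochizukiAbsTopIII2015, Prop 1.4 (ii) p.31] -/
theorem mk_mem_geomCyclotome_of_le (hI : I ≤ cuspidalKernel q) {i : E.arith} (hi : i ∈ I) :
    (QuotientGroup.mk i : CuspidallyCentralQuotient q) ∈ geomCyclotome q :=
  Subgroup.mem_map.mpr ⟨i, hI hi, rfl⟩

/-- `I_x ≤ N` under the cuspidally-central-extension property.
[cite: MochizukiAbsTopIII2015, Prop 1.4 (ii) p.31] -/
theorem IsCuspidallyCentralExtension.le_cuspidalKernel (h : IsCuspidallyCentralExtension q I) :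
    I ≤ cuspidalKernel q :=
  le_sup_left.trans h.sup_eq.le

/-- **`I_x → M_X = Ker(Δ^{c-cn}_{U_x} ↠ Δ_X)`**, the restriction of `Π_{U_x} ↠ Π_{U_x}/[N, Δ]⁻` to `I_x`
(for `I_x ≤ N`). [cite: MochizukiAbsTopIII2015, Prop 1.4 (ii) p.31] -/
def inertiaToGeomCyclotome (hI : I ≤ cuspidalKernel q) : I →* geomCyclotome q where
  toFun i := ⟨QuotientGroup.mk (i : E.arith), mk_mem_geomCyclotome_of_le hI i.2⟩
  map_one' := Subtype.ext (by simp)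
  map_mul' i j := Subtype.ext (by simp)

/-- Value of `inertiaToGeomCyclotome`. [cite: MochizukiAbsTopIII2015, Prop 1.4 (ii) p.31] -/
@[simp] theorem coe_inertiaToGeomCyclotome (hI : I ≤ cuspidalKernel q) (i : I) :
    ((inertiaToGeomCyclotome hI i : geomCyclotome q) : CuspidallyCentralQuotient q) =
      QuotientGroup.mk (i : E.arith) :=
  rfl

/-- `inertiaToGeomCyclotome` is continuous. [cite: MochizukiAbsTopIII2015, Prop 1.4 (ii) p.31] -/
theorem continuous_inertiaToGeomCyclotome (hI : I ≤ cuspidalKernel q) :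
    Continuous (inertiaToGeomCyclotome hI) :=
  Continuous.subtype_mk (QuotientGroup.continuous_mk.comp continuous_subtype_val) _

/-- **Prop. 1.4 (ii), first display, unpacked: `I_x ⥲ Ker(Δ^{c-cn}_{U_x} ↠ Δ_X) = M_X` is a
BIJECTION** whenever `IsCuspidallyCentralExtension q I_x` holds (`I_x ∩ [N, Δ]⁻ = 1` gives
injectivity, `I_x · [N, Δ]⁻ = N` surjectivity).  PROVED from the property.
[cite: MochizukiAbsTopIII2015, Prop 1.4 (ii) p.31] -/
theorem inertiaToGeomCyclotome_bijective (h : IsCuspidallyCentralExtension q I) :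
    Function.Bijective (inertiaToGeomCyclotome h.le_cuspidalKernel) := by
  constructor
  · intro i j hij
    have hij' : (QuotientGroup.mk (i : E.arith) : CuspidallyCentralQuotient q) =
        QuotientGroup.mk (j : E.arith) :=
      congrArg (fun z : geomCyclotome q => (z : CuspidallyCentralQuotient q)) hij
    rw [QuotientGroup.eq] at hij'
    have hmem : (i : E.arith)⁻¹ * j ∈ I ⊓ cuspidallyCentralModulus q :=
      ⟨I.mul_mem (I.inv_mem i.2) j.2, hij'⟩
    rw [h.inf_eq_bot, Subgroup.mem_bot] at hmem
    exact Subtype.ext (inv_mul_eq_one.mp hmem)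
  · rintro ⟨y, hy⟩
    obtain ⟨n, hn, rfl⟩ := Subgroup.mem_map.mp hy
    have hn' : n ∈ I ⊔ cuspidallyCentralModulus q := by
      rw [h.sup_eq]
      exact hn
    have hn'' : n ∈ (I : Set E.arith) * (cuspidallyCentralModulus q : Set E.arith) := by
      rw [← Subgroup.mul_normal]
      exact hn'
    obtain ⟨i, hi, m, hm, rfl⟩ := Set.mem_mul.mp hn''
    refine ⟨⟨i, hi⟩, Subtype.ext ?_⟩
    change (QuotientGroup.mk i : CuspidallyCentralQuotient q) = QuotientGroup.mk' _ (i * m)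
    rw [QuotientGroup.mk'_apply, QuotientGroup.eq, ← mul_assoc, inv_mul_cancel, one_mul]
    exact hm

/-- **`I_x ≃* M_X`** under `IsCuspidallyCentralExtension q I_x`: the identification of `I_x` with
`Ker(Δ^{c-cn}_{U_x} ↠ Δ_X)` expressed by the exact sequence "`1 → I_x → Δ^{c-cn}_{U_x} → Δ_X → 1`".
[cite: MochizukiAbsTopIII2015, Prop 1.4 (ii) p.31] -/
def inertiaEquivGeomCyclotome (h : IsCuspidallyCentralExtension q I) : I ≃* geomCyclotome q :=
  MulEquiv.ofBijective _ (inertiaToGeomCyclotome_bijective h)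

/-- Value of `inertiaEquivGeomCyclotome`. [cite: MochizukiAbsTopIII2015, Prop 1.4 (ii) p.31] -/
@[simp] theorem coe_inertiaEquivGeomCyclotome (h : IsCuspidallyCentralExtension q I) (i : I) :
    ((inertiaEquivGeomCyclotome h i : geomCyclotome q) : CuspidallyCentralQuotient q) =
      QuotientGroup.mk (i : E.arith) :=
  rfl

/-- The identification is compatible with conjugation by `Π_{U_x}` (both sides are restrictions of
the homomorphism `Π_{U_x} ↠ Π_{U_x}/[N, Δ]⁻`): for `g ∈ Π_{U_x}` normalizing `I_x`,
`φ(g i g⁻¹) = ḡ φ(i) ḡ⁻¹`. [cite: MochizukiAbsTopIII2015, Prop 1.4 (ii) p.31] -/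
theorem coe_inertiaEquivGeomCyclotome_conj (h : IsCuspidallyCentralExtension q I) (g : E.arith)
    (i : I) (hgi : g * i * g⁻¹ ∈ I) :
    ((inertiaEquivGeomCyclotome h ⟨g * i * g⁻¹, hgi⟩ : geomCyclotome q) :
        CuspidallyCentralQuotient q) =
      QuotientGroup.mk g * QuotientGroup.mk (i : E.arith) * (QuotientGroup.mk g)⁻¹ := by
  simp only [coe_inertiaEquivGeomCyclotome, QuotientGroup.mk_mul, QuotientGroup.mk_inv]

end InertiaIso

end Literature.AnabelianGeometry.AbsoluteAnabelian.AbsTopIII
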